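import Literature.Analysis.Calculus.HarmonicPolynomialLaplacian
import Literature.Algebra.Polynomial.FischerInnerProduct
import Summits.QuantumFields.YangMills.Theorems.F4SubCurvatureDoorShortRootRigidityTrigonalReflection
import Mathlib
import HarnessLib

/-!
# TorusReduction, part (TR2): the ladder identity `(s·Δ + D)(ρᵏ ψ)` on `ℝ[x₁,x₂,x₃]`

Crux ⟨stmt-QuantumFields-23035⟩ `F4SubCurvatureDoor.ShortRootRigidity`, stub `:146 stub_oddModeRigidity`, piece `TorusReduction`
(`Cruxes/ShortRootRigidity/Lines/odd_mode_split.lean`).  Pure algebra on `P3 = MvPolynomial (Fin 3) ℝ` with the tree's polynomial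
Laplacian `lap = Σᵢ ∂ᵢ²` and `rho = Σᵢ Xᵢ²` (`Literature.Analysis.Calculus.MvPoly`), the divergence-type operator `D = Σᵢ ∂ᵢ` and the
linear form `s = Σᵢ Xᵢ`:

* `lap_rho_pow_succ_mul` — `Δ(ρᵏ⁺¹ ψ) = 2(k+1)(2(k+1)+2d+1) ρᵏ ψ` for `ψ` harmonic homogeneous of degree `d`;
* `sumPderiv_rho_pow_succ_mul` — `D(ρᵏ⁺¹ ψ) = 2(k+1) s ρᵏ ψ + ρᵏ⁺¹ Dψ`;
* `lap_eta_eq_zero` — `η(ψ) := (2d+1)·sψ − ρ·Dψ` is harmonic for `ψ` harmonic homogeneous of degree `d`;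
* `ladder_identity_succ` / `ladder_identity_zero` — `(2d+1)·(s·Δ + D)(ρᵏ ψ)` expressed through `ρᵏ⁻¹ η(ψ)` and `ρᵏ Dψ`.

Mathlib + tree only (`P3 = MvPolynomial (Fin 3) ℝ` from `…TrigonalDefs`); no `sorry`; no new definitions.  HONEST LABEL: algebra helper toward one piece
of an OPEN stub; `:146`, ⟨23035⟩, ⟨23125⟩, R2d and the Yang–Mills mass gap remain OPEN; no summit is proved by a line.
LEAD seat `ym-line-sfw-p2` g76 (cell ym-idea-1, free hands).
-/

noncomputable section

open MvPolynomial
open scoped BigOperators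

namespace Summit.QuantumFields.YangMills.Theorems.F4SubCurvatureDoorTorus

open Literature.Analysis.Calculus.MvPoly (lap rho lap_add lap_smul lap_zero lap_rho_mul isHomogeneous_lap isHomogeneous_rho)
open Literature.Algebra.Polynomial (pderiv_pderiv_comm)
open Summit.QuantumFields.YangMills.Theorems.F4SubCurvatureDoorTrigonalLine (P3)

/-! ## Commutation of partial derivatives and first-order identities -/

/-- `Δ` of a finite sum. -/
theorem lap_sum {ι : Type*} (t : Finset ι) (f : ι → P3) : lap (∑ j ∈ t, f j) = ∑ j ∈ t, lap (f j) := by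
  unfold lap
  simp_rw [map_sum]
  rw [Finset.sum_comm]

/-- `Δ` commutes with every `∂ⱼ`. -/
theorem lap_pderiv (j : Fin 3) (p : P3) : lap (pderiv j p) = pderiv j (lap p) := by
  unfold lap
  rw [map_sum]
  exact Finset.sum_congr rfl fun i _ => by rw [pderiv_pderiv_comm i j, pderiv_pderiv_comm i j (pderiv i p)]

/-- `Δ` commutes with `D = Σⱼ ∂ⱼ`. -/
theorem lap_sumPderiv (p : P3) : lap (∑ j, pderiv j p) = ∑ j, pderiv j (lap p) := by
  rw [lap_sum]
  exact Finset.sum_congr rfl fun j _ => lap_pderiv j p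

/-- `Δ(Xᵢ ψ) = 2 ∂ᵢψ + Xᵢ Δψ`. -/
theorem lap_X_mul (i : Fin 3) (ψ : P3) : lap (X i * ψ) = 2 * pderiv i ψ + X i * lap ψ := by
  unfold lap
  have hterm : ∀ k : Fin 3, pderiv k (pderiv k (X i * ψ)) =
      (if k = i then 2 * pderiv i ψ else 0) + X i * pderiv k (pderiv k ψ) := by
    intro k
    rw [pderiv_mul, pderiv_X, map_add, pderiv_mul, pderiv_mul, pderiv_X]
    by_cases hk : k = i
    · subst hk; simp; ring
    · simp [hk]
  simp_rw [hterm, Finset.sum_add_distrib, Finset.sum_ite_eq', Finset.mem_univ, if_true, ← Finset.mul_sum]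

/-- `Δ(s ψ) = 2 Dψ + s Δψ` for `s = Σᵢ Xᵢ`, `D = Σᵢ ∂ᵢ`. -/
theorem lap_s_mul (ψ : P3) : lap ((∑ i, X i) * ψ) = 2 * ∑ i, pderiv i ψ + (∑ i, X i) * lap ψ := by
  rw [Finset.sum_mul, lap_sum]
  simp_rw [lap_X_mul, Finset.sum_add_distrib, Finset.mul_sum, Finset.sum_mul]

/-- `D(p q) = (Dp) q + p (Dq)`. -/
theorem sumPderiv_mul (p q : P3) : ∑ i, pderiv i (p * q) = (∑ i, pderiv i p) * q + p * ∑ i, pderiv i q := by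
  simp_rw [pderiv_mul, Finset.sum_add_distrib, Finset.sum_mul, Finset.mul_sum]

/-- `D ρ = 2 s`. -/
theorem sumPderiv_rho : ∑ i, pderiv i (rho : P3) = 2 * ∑ i, X i := by
  simp_rw [Literature.Analysis.Calculus.MvPoly.pderiv_rho, Finset.mul_sum]

/-- `D(ρᵏ⁺¹) = 2(k+1) s ρᵏ`. -/
theorem sumPderiv_rho_pow_succ (k : ℕ) :
    ∑ i, pderiv i ((rho : P3) ^ (k + 1)) = (2 * (k + 1 : ℝ)) • ((∑ i, X i) * rho ^ k) := by
  induction k with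
  | zero =>
    rw [zero_add, pow_one, pow_zero, mul_one, sumPderiv_rho, smul_eq_C_mul]
    simp only [Nat.cast_zero, zero_add, mul_one, map_ofNat]
  | succ k ih =>
    rw [pow_succ, sumPderiv_mul, ih, sumPderiv_rho, smul_eq_C_mul, smul_eq_C_mul]
    simp only [map_mul, map_add, map_one, map_natCast, map_ofNat, Nat.cast_add, Nat.cast_one]
    ring

/-- `D(ρᵏ⁺¹ ψ) = 2(k+1) s ρᵏ ψ + ρᵏ⁺¹ Dψ`. -/
theorem sumPderiv_rho_pow_succ_mul (k : ℕ) (ψ : P3) :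
    ∑ i, pderiv i ((rho : P3) ^ (k + 1) * ψ) =
      (2 * (k + 1 : ℝ)) • ((∑ i, X i) * rho ^ k * ψ) + rho ^ (k + 1) * ∑ i, pderiv i ψ := by
  rw [sumPderiv_mul, sumPderiv_rho_pow_succ, smul_mul_assoc]

/-! ## `Δ(ρᵏ ψ)` for harmonic homogeneous `ψ` -/

/-- `Δ(ρᵏ⁺¹ ψ) = 2(k+1)(2(k+1)+2d+1) ρᵏ ψ` for `ψ` harmonic homogeneous of degree `d` (three variables). -/
theorem lap_rho_pow_succ_mul {ψ : P3} {d : ℕ} (hψ : ψ.IsHomogeneous d) (hharm : lap ψ = 0) (k : ℕ) :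
    lap (rho ^ (k + 1) * ψ) = (2 * (k + 1 : ℝ) * (2 * (k + 1) + 2 * d + 1)) • (rho ^ k * ψ) := by
  induction k with
  | zero =>
    rw [zero_add, pow_one, pow_zero, one_mul, lap_rho_mul hψ, hharm, mul_zero, add_zero, smul_eq_C_mul]
    simp only [Nat.cast_ofNat, map_mul, map_add, map_ofNat, map_natCast, map_one]
    ring
  | succ k ih =>
    have hhom : (rho ^ (k + 1) * ψ : P3).IsHomogeneous (2 * (k + 1) + d) :=
      (isHomogeneous_rho.pow (k + 1)).mul hψ
    rw [pow_succ', mul_assoc, lap_rho_mul hhom, ih, smul_eq_C_mul, smul_eq_C_mul]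
    simp only [map_mul, map_add, map_ofNat, map_natCast, map_one, Nat.cast_add, Nat.cast_mul, Nat.cast_ofNat,
      Nat.cast_one]
    ring

/-! ## The harmonic correction `η(ψ) = (2d+1) sψ − ρ Dψ` -/

/-- A homogeneous polynomial of degree `0` has `D = 0`. -/
theorem sumPderiv_eq_zero_of_isHomogeneous_zero {ψ : P3} (hψ : ψ.IsHomogeneous 0) : ∑ i, pderiv i ψ = 0 := by
  have hc : ψ = C (coeff 0 ψ) := by
    have := hψ.totalDegree_le
    exact (totalDegree_eq_zero_iff_eq_C).mp (Nat.le_zero.mp this)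
  rw [hc]; simp

/-- `Δ(ρ · Dψ) = (4d+2) Dψ` for `ψ` harmonic homogeneous of degree `d`. -/
theorem lap_rho_mul_sumPderiv {ψ : P3} {d : ℕ} (hψ : ψ.IsHomogeneous d) (hharm : lap ψ = 0) :
    lap (rho * ∑ i, pderiv i ψ) = (4 * (d : ℝ) + 2) • ∑ i, pderiv i ψ := by
  rcases Nat.eq_zero_or_pos d with rfl | hd
  · rw [sumPderiv_eq_zero_of_isHomogeneous_zero hψ, mul_zero, smul_zero, lap_zero]
  · have hDhom : (∑ i, pderiv i ψ : P3).IsHomogeneous (d - 1) :=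
      IsHomogeneous.sum _ _ _ fun i _ => hψ.pderiv
    rw [lap_rho_mul hDhom, lap_sumPderiv, hharm]
    simp only [map_zero, Finset.sum_const_zero, mul_zero, add_zero, smul_eq_C_mul, map_add, map_mul, map_ofNat,
      map_natCast]
    rw [Nat.cast_sub hd]
    push_cast
    ring

/-- **`η(ψ) := (2d+1)·sψ − ρ·Dψ` is harmonic** for `ψ` harmonic homogeneous of degree `d`. -/
theorem lap_eta_eq_zero {ψ : P3} {d : ℕ} (hψ : ψ.IsHomogeneous d) (hharm : lap ψ = 0) :
    lap ((2 * (d : ℝ) + 1) • ((∑ i, X i) * ψ) - rho * ∑ i, pderiv i ψ) = 0 := by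
  -- `Δ(p − q) = Δp − Δq` is the tree's `…TrigonalLine.lap_sub` (the same sum `Σᵢ ∂ᵢ²`)
  rw [show ∀ p q : P3, lap (p - q) = lap p - lap q from
      Summit.QuantumFields.YangMills.Theorems.F4SubCurvatureDoorTrigonalLine.lap_sub,
    lap_smul, lap_s_mul, hharm, mul_zero, add_zero, lap_rho_mul_sumPderiv hψ hharm,
    show (2 : P3) * ∑ i, pderiv i ψ = (2 : ℝ) • ∑ i, pderiv i ψ by rw [smul_eq_C_mul, map_ofNat],
    smul_smul, ← sub_smul, show (2 * (d : ℝ) + 1) * 2 - (4 * (d : ℝ) + 2) = 0 by ring, zero_smul]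

/-- `η(ψ)` is homogeneous of degree `d + 1`. -/
theorem isHomogeneous_eta {ψ : P3} {d : ℕ} (hψ : ψ.IsHomogeneous d) :
    ((2 * (d : ℝ) + 1) • ((∑ i, X i) * ψ) - rho * ∑ i, pderiv i ψ : P3).IsHomogeneous (d + 1) := by
  have hs : (∑ i : Fin 3, (X i : P3)).IsHomogeneous 1 := IsHomogeneous.sum _ _ _ fun i _ => isHomogeneous_X ℝ i
  have h1 : ((2 * (d : ℝ) + 1) • ((∑ i, X i) * ψ) : P3).IsHomogeneous (d + 1) := by
    have := (hs.mul hψ)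
    rw [add_comm] at this
    rw [smul_eq_C_mul]
    simpa using (isHomogeneous_C _ (2 * (d : ℝ) + 1)).mul this
  refine h1.sub ?_
  rcases Nat.eq_zero_or_pos d with rfl | hd
  · rw [sumPderiv_eq_zero_of_isHomogeneous_zero hψ, mul_zero]; exact isHomogeneous_zero _ _ _
  · have h2 := isHomogeneous_rho.mul (IsHomogeneous.sum _ _ _ fun i (_ : i ∈ Finset.univ) => hψ.pderiv (i := i))
    rwa [show 2 + (d - 1) = d + 1 by omega] at h2


/-! ## The ladder identity -/

/-- **Ladder identity.**  For `ψ` harmonic homogeneous of degree `d` and `k : ℕ`,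
`s·Δ(ρᵏψ) + D(ρᵏψ) = 2k(2k+2d+2)·ρᵏ⁻¹ η'(ψ) + (2k(2k+2d+2)(2d+1)⁻¹ + 1)·ρᵏ Dψ`
with the harmonic `η'(ψ) = sψ − (2d+1)⁻¹ ρ Dψ` (for `k = 0` the first term is absent). -/
theorem ladder_identity {ψ : P3} {d : ℕ} (hψ : ψ.IsHomogeneous d) (hharm : lap ψ = 0) (k : ℕ) :
    (∑ i, X i) * lap (rho ^ k * ψ) + ∑ i, pderiv i (rho ^ k * ψ) =
      (2 * (k : ℝ) * (2 * k + 2 * d + 2)) • (rho ^ (k - 1) * ((∑ i, X i) * ψ - (2 * (d : ℝ) + 1)⁻¹ • (rho * ∑ i, pderiv i ψ)))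
        + (2 * (k : ℝ) * (2 * k + 2 * d + 2) * (2 * (d : ℝ) + 1)⁻¹ + 1) • (rho ^ k * ∑ i, pderiv i ψ) := by
  rcases k with _ | k
  · simp only [pow_zero, one_mul, hharm, mul_zero, zero_add, Nat.cast_zero, mul_zero, zero_mul, zero_smul,
      one_smul]
  · rw [lap_rho_pow_succ_mul hψ hharm k, sumPderiv_rho_pow_succ_mul, Nat.add_sub_cancel, mul_sub, smul_sub,
      mul_smul_comm, pow_succ]
    simp only [smul_eq_C_mul, Nat.cast_add, Nat.cast_one, map_mul, map_add, map_ofNat, map_natCast, map_one]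
    ring

/-- `Δ` iterated is additive over finite sums. -/
theorem lap_iterate_sum {ι : Type*} (t : Finset ι) (f : ι → P3) (r : ℕ) :
    lap^[r] (∑ j ∈ t, f j) = ∑ j ∈ t, lap^[r] (f j) := by
  induction r with
  | zero => simp
  | succ r ih => rw [Function.iterate_succ_apply', ih, lap_sum]; simp [Function.iterate_succ_apply']

/-- `Δ^[r] (c • p) = c • Δ^[r] p`. -/
theorem lap_iterate_smul (c : ℝ) (p : P3) (r : ℕ) : lap^[r] (c • p) = c • lap^[r] p := by
  induction r with
  | zero => simp
  | succ r ih => rw [Function.iterate_succ_apply', ih, lap_smul, Function.iterate_succ_apply']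

/-- `Δ^[r] 0 = 0`. -/
theorem lap_iterate_zero (r : ℕ) : lap^[r] (0 : P3) = 0 := by
  induction r with
  | zero => simp
  | succ r ih => rw [Function.iterate_succ_apply', ih, lap_zero]

/-- Iterated Laplacians of `ρʲ Q` for harmonic homogeneous `Q`: for `t ≤ j`, `Δ^[t](ρʲ Q) = c · ρʲ⁻ᵗ Q` with `c ≠ 0`. -/
theorem lap_iterate_rho_pow_mul {Q : P3} {d : ℕ} (hQ : Q.IsHomogeneous d) (hharm : lap Q = 0) (j : ℕ) :
    ∀ t ≤ j, ∃ c : ℝ, c ≠ 0 ∧ lap^[t] (rho ^ j * Q) = c • (rho ^ (j - t) * Q) := by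
  intro t
  induction t with
  | zero => intro _; exact ⟨1, one_ne_zero, by simp⟩
  | succ t ih =>
    intro ht
    obtain ⟨c, hc, hct⟩ := ih (by omega)
    obtain ⟨i, hi⟩ : ∃ i, j - t = i + 1 := ⟨j - t - 1, by omega⟩
    refine ⟨c * (2 * (i + 1 : ℝ) * (2 * (i + 1) + 2 * d + 1)), mul_ne_zero hc (by positivity), ?_⟩
    rw [Function.iterate_succ_apply', hct, lap_smul, hi, lap_rho_pow_succ_mul hQ hharm i, smul_smul,
      show j - (t + 1) = i by omega]

/-- Beyond `j` the iterated Laplacians of `ρʲ Q` vanish (`Q` harmonic homogeneous). -/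
theorem lap_iterate_rho_pow_mul_eq_zero {Q : P3} {d : ℕ} (hQ : Q.IsHomogeneous d) (hharm : lap Q = 0) (j : ℕ) :
    ∀ t, j < t → lap^[t] (rho ^ j * Q) = 0 := by
  intro t ht
  obtain ⟨r, rfl⟩ : ∃ r, t = j + 1 + r := ⟨t - (j + 1), by omega⟩
  induction r with
  | zero =>
    obtain ⟨c, -, hc⟩ := lap_iterate_rho_pow_mul hQ hharm j j le_rfl
    rw [add_zero, Function.iterate_succ_apply', hc, lap_smul, Nat.sub_self, pow_zero, one_mul, hharm, smul_zero]
  | succ r ih =>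
    rw [show j + 1 + (r + 1) = (j + 1 + r) + 1 by omega, Function.iterate_succ_apply', ih (by omega), lap_zero]

/-- **Uniqueness of the harmonic Fischer expansion** (three variables): if `Σ_{j ≤ K} ρʲ Q_j = 0` with every `Q_j` harmonic and
homogeneous (of any degrees), then every `Q_j = 0` (`j ≤ K`). -/
theorem eq_zero_of_sum_rho_pow_mul_eq_zero (Q : ℕ → P3) (d : ℕ → ℕ) (hhom : ∀ j, (Q j).IsHomogeneous (d j))
    (hharm : ∀ j, lap (Q j) = 0) :
    ∀ K : ℕ, ∑ j ∈ Finset.range (K + 1), rho ^ j * Q j = 0 → ∀ j ≤ K, Q j = 0 := by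
  intro K
  induction K with
  | zero =>
    intro h j hj
    obtain rfl : j = 0 := Nat.le_zero.mp hj
    simpa using h
  | succ K ih =>
    intro h j hj
    -- apply `Δ^[K+1]`: only the top term survives
    have htop : Q (K + 1) = 0 := by
      have h1 := congrArg (fun p => lap^[K + 1] p) h
      simp only [lap_iterate_sum, lap_iterate_zero] at h1
      rw [Finset.sum_range_succ, Finset.sum_eq_zero (fun i hi => ?_), zero_add] at h1
      · obtain ⟨c, hc, hcK⟩ := lap_iterate_rho_pow_mul (hhom (K + 1)) (hharm (K + 1)) (K + 1) (K + 1) le_rfl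
        rw [hcK, Nat.sub_self, pow_zero, one_mul] at h1
        exact (smul_eq_zero.mp h1).resolve_left hc
      · exact lap_iterate_rho_pow_mul_eq_zero (hhom i) (hharm i) i (K + 1) (Finset.mem_range.mp hi)
    rcases Nat.lt_or_ge j (K + 1) with hlt | hge
    · refine ih ?_ j (by omega)
      rw [Finset.sum_range_succ, htop, mul_zero, add_zero] at h
      exact h
    · obtain rfl : j = K + 1 := le_antisymm hj hge
      exact htop

end Summit.QuantumFields.YangMills.Theorems.F4SubCurvatureDoorTorus

end
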